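import Summits.CriticalPhenomena.CardyFormulaZ2.Theorems.CardyComplexConeEdgePrecompactUFRSStrandsArmsPieces
import Literature.Topology.PlaneTopology.TightPolyline

/-!
# Strands ⇒ arms, III: the tight arc, the middle dart and the chain of an orbit stretch
(line `qkz-strip-boundary-arm` of crux `CardyComplexCone.EdgePrecompact`, stmt-CriticalPhenomena-11387;
the per-strand input of the sector argument for the registered sub-goal `ufrs_strands_zdDomArms`)

Mesh `1`. An orbit stretch `O q [0, n]` of `nextCorner β` whose first vertex is within `r` of a
point `z` and whose last vertex is at distance `≥ R ≥ r + 16` (or conversely) is trimmed twice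
(`PlaneTopology.exists_tight_polyline`, as in `MedialTraversalArcs.exists_traversal_arc` but
with the sharp constants of `…UFRSStrandsArmsPieces.lean`, every piece having diameter `< 1/2`):

* a TIGHT ARC `T` of its perturbed polyline across the closed annulus
  `r + 1/2 ≤ |w - z| ≤ R - 1/2`, meeting each circle only at its endpoint (the input format of
  `PlaneTopology.not_three_arcs_touch`);
* a MIDDLE DART `m` whose piece lies on `T`, strictly inside the annulus;
* a CHAIN of corners `i' ≤ m ≤ j'` of the stretch whose vertices and face centres are at
  distance in `(r + 1, R - 1)` from `z`, one end within `r + 3`, the other beyond `R - 3`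
  (`strand_tightArc`, registered sub-goal `ufrs_strandTightArc`).

The abstract two-level trimming is `tight2_inc` / `tight2_dec` (chains of segments of diameter
`< 1/2`, increasing / decreasing direction).

References: M. Aizenman, A. Burchard, Duke Math. J. 99 (1999), Appendix A (crossing segments of
a curve traversing an annulus); S. Smirnov, C. R. Acad. Sci. Paris 333 (2001), §2.
-/

namespace Summit.CriticalPhenomena.CardyFormulaZ2.Cruxes.EdgePrecompact.QkzStripBoundaryArm

open MeasureTheory Filter Set Metric Complex
open scoped Topology BigOperators Pointwise
open Literature.Probability.LatticeModels Literature.Probability.Percolation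
open Literature.Probability.RandomPlanarGeometry (DobrushinDomain)
open Summit.CriticalPhenomena.CardyFormulaZ2.Theses.CardyComplexCone
open Literature.Topology.PlaneTopology

noncomputable section

/-! ## Chains of short segments: adjacent pieces are close, the middle piece is far from the ends -/

/-- Points on two pieces of index distance `≤ 1` of a chain of segments of diameter `< 1/2` are
within `1` of each other. -/
theorem dist_lt_one_of_adj (pts : ℕ → ℂ) {ps pe : ℕ}
    (hdiam : ∀ p, ps ≤ p → p ≤ pe → ∀ z ∈ segment ℝ (pts p) (pts (p + 1)),
      ∀ w ∈ segment ℝ (pts p) (pts (p + 1)), dist z w < 1 / 2)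
    {p p' : ℕ} (hp : ps ≤ p) (hp' : p' ≤ pe) (hpp' : p ≤ p') (hp'p : p' ≤ p + 1) {z w : ℂ}
    (hz : z ∈ segment ℝ (pts p) (pts (p + 1))) (hw : w ∈ segment ℝ (pts p') (pts (p' + 1))) : dist z w < 1 := by
  rcases Nat.eq_or_lt_of_le hpp' with rfl | hlt
  · linarith [hdiam p hp hp' z hz w hw]
  · obtain rfl : p' = p + 1 := by omega
    have h1 := hdiam p hp (by omega) z hz (pts (p + 1)) (right_mem_segment _ _ _)
    have h2 := hdiam (p + 1) (by omega) hp' (pts (p + 1)) (left_mem_segment _ _ _) w hw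
    linarith [dist_triangle z (pts (p + 1)) w]

/-- **The middle piece is at index distance `≥ 2` from both ends.** If a point `z₀` of the pieces
`pl … ph` is at distance `c` from `x` while the end pieces `pl`, `ph` carry points whose distance
from `x` differs from `c` by `≥ 1`, the piece of `z₀` has index in `[pl + 2, ph - 2]`. -/
theorem exists_middle_index (pts : ℕ → ℂ) (x : ℂ) {ps pe pl ph : ℕ}
    (hdiam : ∀ p, ps ≤ p → p ≤ pe → ∀ z ∈ segment ℝ (pts p) (pts (p + 1)),
      ∀ w ∈ segment ℝ (pts p) (pts (p + 1)), dist z w < 1 / 2)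
    (hps : ps ≤ pl) (hph : ph ≤ pe) {c : ℝ} {z₀ : ℂ}
    (hz₀ : z₀ ∈ ⋃ p ∈ Finset.Icc pl ph, segment ℝ (pts p) (pts (p + 1))) (hc : dist z₀ x = c)
    (hzl : ∃ zl ∈ segment ℝ (pts pl) (pts (pl + 1)), 1 ≤ |dist zl x - c|)
    (hzh : ∃ zh ∈ segment ℝ (pts ph) (pts (ph + 1)), 1 ≤ |dist zh x - c|) :
    ∃ p₀, pl + 2 ≤ p₀ ∧ p₀ + 2 ≤ ph ∧ z₀ ∈ segment ℝ (pts p₀) (pts (p₀ + 1)) := by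
  obtain ⟨p₀, hp₀, hz₀p⟩ := mem_iUnion₂.1 hz₀
  rw [Finset.mem_Icc] at hp₀
  obtain ⟨zl, hzl, hzld⟩ := hzl
  obtain ⟨zh, hzh, hzhd⟩ := hzh
  refine ⟨p₀, ?_, ?_, hz₀p⟩
  · by_contra h
    have hd := dist_lt_one_of_adj pts hdiam hps (by omega) hp₀.1 (by omega) hzl hz₀p
    have := abs_dist_sub_le zl z₀ x
    rw [hc] at this
    linarith
  · by_contra h
    have hd := dist_lt_one_of_adj pts hdiam (by omega) hph hp₀.2 (by omega) hz₀p hzh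
    have := abs_dist_sub_le zh z₀ x
    rw [hc] at this
    rw [dist_comm] at hd
    linarith

/-- A point of a path at a prescribed intermediate distance from `x`. -/
theorem exists_mem_range_dist_eq {E F x : ℂ} (T : Path E F) {c : ℝ}
    (h : (dist E x ≤ c ∧ c ≤ dist F x) ∨ (dist F x ≤ c ∧ c ≤ dist E x)) : ∃ z₀ ∈ range T, dist z₀ x = c := by
  have hTc : Continuous fun u : unitInterval => dist (T u) x := T.continuous.dist continuous_const
  rcases h with ⟨h1, h2⟩ | ⟨h1, h2⟩
  · obtain ⟨u₀, hu₀⟩ := intermediate_value_univ 0 1 hTc (⟨by rw [T.source]; exact h1, by rw [T.target]; exact h2⟩ :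
      c ∈ Icc (dist (T 0) x) (dist (T 1) x))
    exact ⟨T u₀, ⟨u₀, rfl⟩, hu₀⟩
  · obtain ⟨u₀, hu₀⟩ := intermediate_value_univ 1 0 hTc (⟨by rw [T.target]; exact h1, by rw [T.source]; exact h2⟩ :
      c ∈ Icc (dist (T 1) x) (dist (T 0) x))
    exact ⟨T u₀, ⟨u₀, rfl⟩, hu₀⟩

/-! ## Two-level trimming of a chain of short segments -/

/-- **Two-level trimming, increasing direction.** A chain of segments `[pts p, pts (p+1)]`,
`ps ≤ p ≤ pe`, of diameter `< 1/2`, from inside the circle of radius `q₁` about `x` to outside the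
circle of radius `q₂ ≥ q₁ + 4`, contains: a tight crossing `T` of the closed annulus `[q₁, q₂]`
carried by the pieces `lo … hi`, all pieces strictly between lying on `T` and strictly inside the
annulus; an inner range `pl … ph` whose interior pieces are at distance in `(q₁ + 1, q₂ - 1)` and
whose end pieces carry points at distance `q₁ + 1`, `q₂ - 1`; and a middle index `p₀` with
`pl + 2 ≤ p₀ ≤ ph - 2`. -/
theorem tight2_inc (pts : ℕ → ℂ) (x : ℂ) {q₁ q₂ : ℝ} {ps pe : ℕ} (hpse : ps ≤ pe) (hq : q₁ + 4 ≤ q₂)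
    (hdiam : ∀ p, ps ≤ p → p ≤ pe → ∀ z ∈ segment ℝ (pts p) (pts (p + 1)),
      ∀ w ∈ segment ℝ (pts p) (pts (p + 1)), dist z w < 1 / 2)
    (hstart : dist (pts ps) x < q₁) (hend : q₂ < dist (pts (pe + 1)) x) :
    ∃ (lo hi : ℕ) (E F : ℂ) (T : Path E F) (pl ph p₀ : ℕ),
      ps ≤ lo ∧ lo < pl ∧ pl + 2 ≤ p₀ ∧ p₀ + 2 ≤ ph ∧ ph < hi ∧ hi ≤ pe ∧
      dist E x = q₁ ∧ dist F x = q₂ ∧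
      range T ⊆ (⋃ p ∈ Finset.Icc lo hi, segment ℝ (pts p) (pts (p + 1))) ∧
      (∀ z ∈ range T, q₁ ≤ dist z x ∧ dist z x ≤ q₂ ∧ (dist z x = q₁ → z = E) ∧ (dist z x = q₂ → z = F)) ∧
      (∀ p, lo < p → p < hi → segment ℝ (pts p) (pts (p + 1)) ⊆ range T) ∧
      (∀ p, lo < p → p < hi → ∀ z ∈ segment ℝ (pts p) (pts (p + 1)), q₁ < dist z x ∧ dist z x < q₂) ∧
      (∀ p, pl < p → p < ph → ∀ z ∈ segment ℝ (pts p) (pts (p + 1)), q₁ + 1 < dist z x ∧ dist z x < q₂ - 1) ∧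
      (((∃ zl ∈ segment ℝ (pts pl) (pts (pl + 1)), dist zl x = q₁ + 1) ∧
          (∃ zh ∈ segment ℝ (pts ph) (pts (ph + 1)), dist zh x = q₂ - 1)) ∨
        ((∃ zl ∈ segment ℝ (pts pl) (pts (pl + 1)), dist zl x = q₂ - 1) ∧
          (∃ zh ∈ segment ℝ (pts ph) (pts (ph + 1)), dist zh x = q₁ + 1))) := by
  have hdiam' : ∀ {c : ℝ}, 1 / 2 ≤ c → ∀ p, ps ≤ p → p ≤ pe → ∀ z ∈ segment ℝ (pts p) (pts (p + 1)),
      ∀ w ∈ segment ℝ (pts p) (pts (p + 1)), dist z w < c :=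
    fun hc p h1 h2 z hz w hw => (hdiam p h1 h2 z hz w hw).trans_le hc
  obtain ⟨p₁, p₂, E, F, T, hp₁, hp₁₂, hp₂, hE, hF, hEd, hFd, hrange, hsub, htight, hlt₂, hgt₁⟩ :=
    exists_tight_polyline pts x hpse (hdiam' (by linarith)) hstart hend
  -- the two end pieces are not adjacent
  have hgap : p₁ + 2 ≤ p₂ := by
    by_contra h
    have hd := dist_lt_one_of_adj pts hdiam hp₁ hp₂ hp₁₂.le (by omega) hE hF
    have := abs_dist_sub_le E F x
    rw [hEd, hFd, abs_of_nonpos (by linarith)] at this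
    linarith
  -- second level on the whole pieces `p₁ < p < p₂`
  have hstart' : dist (pts (p₁ + 1)) x < q₁ + 1 := by
    have h := hdiam p₁ hp₁ (by omega) (pts (p₁ + 1)) (right_mem_segment _ _ _) E hE
    linarith [dist_triangle (pts (p₁ + 1)) E x]
  have hend' : q₂ - 1 < dist (pts (p₂ - 1 + 1)) x := by
    rw [show p₂ - 1 + 1 = p₂ by omega]
    have h := hdiam p₂ (by omega) hp₂ (pts p₂) (left_mem_segment _ _ _) F hF
    linarith [dist_triangle F (pts p₂) x, dist_comm F (pts p₂)]
  obtain ⟨pl, ph, E', F', T', hpl, hplh, hph, hE', hF', hE'd, hF'd, -, hsub', -, hlt₂', hgt₁'⟩ :=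
    exists_tight_polyline pts x (q₁ := q₁ + 1) (q₂ := q₂ - 1) (ps := p₁ + 1) (pe := p₂ - 1) (by omega)
      (fun p h1 h2 => hdiam' (by linarith) p (by omega) (by omega)) hstart' hend'
  -- the middle point and its piece
  obtain ⟨z₀, hz₀, hz₀d⟩ := exists_mem_range_dist_eq T' (c := (q₁ + q₂) / 2)
    (Or.inl ⟨by rw [hE'd]; linarith, by rw [hF'd]; linarith⟩)
  obtain ⟨p₀, hp₀l, hp₀h, -⟩ := exists_middle_index pts x hdiam (pl := pl) (ph := ph) (by omega) (by omega)
    (hsub' hz₀) hz₀d ⟨E', hE', by rw [hE'd, abs_of_nonpos (by linarith)]; linarith⟩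
    ⟨F', hF', by rw [hF'd, abs_of_nonneg (by linarith)]; linarith⟩
  refine ⟨p₁, p₂, E, F, T, pl, ph, p₀, hp₁, by omega, hp₀l, hp₀h, by omega, hp₂, hEd, hFd, hsub, htight,
    fun p h1 h2 => ?_, fun p h1 h2 z hz => ⟨hgt₁ p h1 h2.le z hz, hlt₂ p (by omega) h2 z hz⟩,
    fun p h1 h2 z hz => ⟨hgt₁' p h1 h2.le z hz, hlt₂' p (by omega) h2 z hz⟩,
    Or.inl ⟨⟨E', hE', hE'd⟩, ⟨F', hF', hF'd⟩⟩⟩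
  rw [hrange]
  intro z hz
  exact Or.inl (Or.inr (mem_iUnion₂.2 ⟨p, Finset.mem_Ioo.2 ⟨h1, h2⟩, hz⟩))

/-- **Two-level trimming, decreasing direction** (the chain runs from outside the circle of
radius `q₂` to inside the circle of radius `q₁`; same conclusion, by `exists_tight_polyline'`). -/
theorem tight2_dec (pts : ℕ → ℂ) (x : ℂ) {q₁ q₂ : ℝ} {ps pe : ℕ} (hpse : ps ≤ pe) (hq : q₁ + 4 ≤ q₂)
    (hdiam : ∀ p, ps ≤ p → p ≤ pe → ∀ z ∈ segment ℝ (pts p) (pts (p + 1)),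
      ∀ w ∈ segment ℝ (pts p) (pts (p + 1)), dist z w < 1 / 2)
    (hstart : q₂ < dist (pts ps) x) (hend : dist (pts (pe + 1)) x < q₁) :
    ∃ (lo hi : ℕ) (E F : ℂ) (T : Path E F) (pl ph p₀ : ℕ),
      ps ≤ lo ∧ lo < pl ∧ pl + 2 ≤ p₀ ∧ p₀ + 2 ≤ ph ∧ ph < hi ∧ hi ≤ pe ∧
      dist E x = q₁ ∧ dist F x = q₂ ∧
      range T ⊆ (⋃ p ∈ Finset.Icc lo hi, segment ℝ (pts p) (pts (p + 1))) ∧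
      (∀ z ∈ range T, q₁ ≤ dist z x ∧ dist z x ≤ q₂ ∧ (dist z x = q₁ → z = E) ∧ (dist z x = q₂ → z = F)) ∧
      (∀ p, lo < p → p < hi → segment ℝ (pts p) (pts (p + 1)) ⊆ range T) ∧
      (∀ p, lo < p → p < hi → ∀ z ∈ segment ℝ (pts p) (pts (p + 1)), q₁ < dist z x ∧ dist z x < q₂) ∧
      (∀ p, pl < p → p < ph → ∀ z ∈ segment ℝ (pts p) (pts (p + 1)), q₁ + 1 < dist z x ∧ dist z x < q₂ - 1) ∧
      (((∃ zl ∈ segment ℝ (pts pl) (pts (pl + 1)), dist zl x = q₁ + 1) ∧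
          (∃ zh ∈ segment ℝ (pts ph) (pts (ph + 1)), dist zh x = q₂ - 1)) ∨
        ((∃ zl ∈ segment ℝ (pts pl) (pts (pl + 1)), dist zl x = q₂ - 1) ∧
          (∃ zh ∈ segment ℝ (pts ph) (pts (ph + 1)), dist zh x = q₁ + 1))) := by
  have hdiam' : ∀ {c : ℝ}, 1 / 2 ≤ c → ∀ p, ps ≤ p → p ≤ pe → ∀ z ∈ segment ℝ (pts p) (pts (p + 1)),
      ∀ w ∈ segment ℝ (pts p) (pts (p + 1)), dist z w < c :=
    fun hc p h1 h2 z hz w hw => (hdiam p h1 h2 z hz w hw).trans_le hc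
  obtain ⟨p₁, p₂, E, F, T, hp₂, hp₂₁, hp₁, hE, hF, hEd, hFd, hrange, hsub, htight, hlt₂, hgt₁⟩ :=
    exists_tight_polyline' pts x hpse (hdiam' (by linarith)) hstart hend
  have hgap : p₂ + 2 ≤ p₁ := by
    by_contra h
    have hd := dist_lt_one_of_adj pts hdiam hp₂ hp₁ hp₂₁.le (by omega) hF hE
    have := abs_dist_sub_le F E x
    rw [hEd, hFd, abs_of_nonneg (by linarith)] at this
    linarith
  have hstart' : q₂ - 1 < dist (pts (p₂ + 1)) x := by
    have h := hdiam p₂ hp₂ (by omega) (pts (p₂ + 1)) (right_mem_segment _ _ _) F hF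
    linarith [dist_triangle F (pts (p₂ + 1)) x, dist_comm F (pts (p₂ + 1))]
  have hend' : dist (pts (p₁ - 1 + 1)) x < q₁ + 1 := by
    rw [show p₁ - 1 + 1 = p₁ by omega]
    have h := hdiam p₁ (by omega) hp₁ (pts p₁) (left_mem_segment _ _ _) E hE
    linarith [dist_triangle (pts p₁) E x]
  obtain ⟨ph, pl, E', F', T', hpl, hplh, hph, hE', hF', hE'd, hF'd, -, hsub', -, hlt₂', hgt₁'⟩ :=
    exists_tight_polyline' pts x (q₁ := q₁ + 1) (q₂ := q₂ - 1) (ps := p₂ + 1) (pe := p₁ - 1) (by omega)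
      (fun p h1 h2 => hdiam' (by linarith) p (by omega) (by omega)) hstart' hend'
  obtain ⟨z₀, hz₀, hz₀d⟩ := exists_mem_range_dist_eq T' (c := (q₁ + q₂) / 2)
    (Or.inl ⟨by rw [hE'd]; linarith, by rw [hF'd]; linarith⟩)
  obtain ⟨p₀, hp₀l, hp₀h, -⟩ := exists_middle_index pts x hdiam (pl := pl) (ph := ph) (by omega) (by omega)
    (hsub' hz₀) hz₀d ⟨F', hF', by rw [hF'd, abs_of_nonneg (by linarith)]; linarith⟩
    ⟨E', hE', by rw [hE'd, abs_of_nonpos (by linarith)]; linarith⟩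
  refine ⟨p₂, p₁, E, F, T, pl, ph, p₀, hp₂, by omega, hp₀l, hp₀h, by omega, hp₁, hEd, hFd, hsub, htight,
    fun p h1 h2 => ?_, fun p h1 h2 z hz => ⟨hgt₁ p h1.le h2 z hz, hlt₂ p h1 (by omega) z hz⟩,
    fun p h1 h2 z hz => ⟨hgt₁' p h1.le h2 z hz, hlt₂' p h1 (by omega) z hz⟩,
    Or.inr ⟨⟨F', hF', hF'd⟩, ⟨E', hE', hE'd⟩⟩⟩
  rw [hrange]
  intro z hz
  exact Or.inl (Or.inr (mem_iUnion₂.2 ⟨p, Finset.mem_Ioo.2 ⟨h1, h2⟩, hz⟩))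

/-! ## The tight arc, middle dart and chain of an orbit stretch -/

/-- **The tight arc, the middle dart and the chain of an orbit stretch** (mesh `1`). For a
stretch `O q [0, n]` of an orbit of `nextCorner β` whose first vertex is within `r` of `z` and
whose last vertex is at distance `≥ R` from `z`, or conversely, where `r + 16 ≤ R`: a tight arc
`T` of its perturbed polyline across the closed annulus `[r + 1/2, R - 1/2]` about `z`; a dart
`m` of the stretch whose piece lies on `T` strictly inside the annulus; a chain `i' ≤ m ≤ j' ≤ n`
of corners of the stretch with vertices and face centres at distance in `(r + 1, R - 1)`, one
end within `r + 3` and the other beyond `R - 3`. -/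
theorem strand_tightArc (β : BondConfig (Site 2)) (q : Site 2 × Fin 4) (n : ℕ) (z : ℂ) {r R : ℝ}
    (hrR : r + 16 ≤ R)
    (hdir : (dist (Site.toComplex (cornerOrbit β q 0).1) z ≤ r ∧ R ≤ dist (Site.toComplex (cornerOrbit β q n).1) z) ∨
      (R ≤ dist (Site.toComplex (cornerOrbit β q 0).1) z ∧ dist (Site.toComplex (cornerOrbit β q n).1) z ≤ r)) :
    ∃ (E F : ℂ) (T : Path E F) (m i' j' : ℕ),
      dist E z = r + 1 / 2 ∧ dist F z = R - 1 / 2 ∧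
      (∀ w ∈ range T, r + 1 / 2 ≤ dist w z ∧ dist w z ≤ R - 1 / 2 ∧
        (dist w z = r + 1 / 2 → w = E) ∧ (dist w z = R - 1 / 2 → w = F)) ∧
      range T ⊆ (⋃ jj ∈ Finset.range (2 * n + 1), segment ℝ (pieceVert β q jj) (pieceVert β q (jj + 1))) ∧
      segment ℝ (sPt (cornerOrbit β q m)) (tPt (cornerOrbit β q m)) ⊆ range T ∧
      (∀ w ∈ segment ℝ (sPt (cornerOrbit β q m)) (tPt (cornerOrbit β q m)), r + 1 / 2 < dist w z ∧ dist w z < R - 1 / 2) ∧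
      i' ≤ m ∧ m ≤ j' ∧ j' ≤ n ∧
      (∀ t, i' ≤ t → t ≤ j' →
        r + 1 < dist (Site.toComplex (cornerOrbit β q t).1) z ∧ dist (Site.toComplex (cornerOrbit β q t).1) z < R - 1 ∧
        r + 1 < dist (faceCenter (cFace (cornerOrbit β q t))) z ∧ dist (faceCenter (cFace (cornerOrbit β q t))) z < R - 1) ∧
      ((dist (Site.toComplex (cornerOrbit β q i').1) z < r + 3 ∧ dist (faceCenter (cFace (cornerOrbit β q i'))) z < r + 3 ∧
          R - 3 < dist (Site.toComplex (cornerOrbit β q j').1) z ∧ R - 3 < dist (faceCenter (cFace (cornerOrbit β q j'))) z) ∨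
        (R - 3 < dist (Site.toComplex (cornerOrbit β q i').1) z ∧ R - 3 < dist (faceCenter (cFace (cornerOrbit β q i'))) z ∧
          dist (Site.toComplex (cornerOrbit β q j').1) z < r + 3 ∧ dist (faceCenter (cFace (cornerOrbit β q j'))) z < r + 3)) := by
  set pts : ℕ → ℂ := pieceVert β q with hpts
  have hdiam : ∀ p, 0 ≤ p → p ≤ 2 * n → ∀ a ∈ segment ℝ (pts p) (pts (p + 1)),
      ∀ b ∈ segment ℝ (pts p) (pts (p + 1)), dist a b < 1 / 2 :=
    fun p _ _ a ha b hb => piece_diam_lt β q p ha hb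
  have h0 : dist (pts 0) (Site.toComplex (cornerOrbit β q 0).1) < 1 / 2 := dist_pieceVert_vertex_lt β q 0
  have hN : dist (pts (2 * n + 1)) (Site.toComplex (cornerOrbit β q n).1) < 1 / 2 := by
    have := dist_pieceVert_vertex_lt β q (2 * n + 1)
    rwa [show (2 * n + 1) / 2 = n by omega] at this
  have key : ∃ (lo hi : ℕ) (E F : ℂ) (T : Path E F) (pl ph p₀ : ℕ),
      0 ≤ lo ∧ lo < pl ∧ pl + 2 ≤ p₀ ∧ p₀ + 2 ≤ ph ∧ ph < hi ∧ hi ≤ 2 * n ∧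
      dist E z = r + 1 / 2 ∧ dist F z = R - 1 / 2 ∧
      range T ⊆ (⋃ p ∈ Finset.Icc lo hi, segment ℝ (pts p) (pts (p + 1))) ∧
      (∀ w ∈ range T, r + 1 / 2 ≤ dist w z ∧ dist w z ≤ R - 1 / 2 ∧
        (dist w z = r + 1 / 2 → w = E) ∧ (dist w z = R - 1 / 2 → w = F)) ∧
      (∀ p, lo < p → p < hi → segment ℝ (pts p) (pts (p + 1)) ⊆ range T) ∧
      (∀ p, lo < p → p < hi → ∀ w ∈ segment ℝ (pts p) (pts (p + 1)), r + 1 / 2 < dist w z ∧ dist w z < R - 1 / 2) ∧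
      (∀ p, pl < p → p < ph → ∀ w ∈ segment ℝ (pts p) (pts (p + 1)), r + 1 / 2 + 1 < dist w z ∧ dist w z < R - 1 / 2 - 1) ∧
      (((∃ zl ∈ segment ℝ (pts pl) (pts (pl + 1)), dist zl z = r + 1 / 2 + 1) ∧
          (∃ zh ∈ segment ℝ (pts ph) (pts (ph + 1)), dist zh z = R - 1 / 2 - 1)) ∨
        ((∃ zl ∈ segment ℝ (pts pl) (pts (pl + 1)), dist zl z = R - 1 / 2 - 1) ∧
          (∃ zh ∈ segment ℝ (pts ph) (pts (ph + 1)), dist zh z = r + 1 / 2 + 1))) := by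
    rcases hdir with ⟨h1, h2⟩ | ⟨h1, h2⟩
    · exact tight2_inc pts z (ps := 0) (pe := 2 * n) (Nat.zero_le _) (by linarith) hdiam
        (by linarith [dist_triangle (pts 0) (Site.toComplex (cornerOrbit β q 0).1) z])
        (by linarith [dist_triangle (Site.toComplex (cornerOrbit β q n).1) (pts (2 * n + 1)) z,
          dist_comm (pts (2 * n + 1)) (Site.toComplex (cornerOrbit β q n).1)])
    · exact tight2_dec pts z (ps := 0) (pe := 2 * n) (Nat.zero_le _) (by linarith) hdiam
        (by linarith [dist_triangle (Site.toComplex (cornerOrbit β q 0).1) (pts 0) z,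
          dist_comm (pts 0) (Site.toComplex (cornerOrbit β q 0).1)])
        (by linarith [dist_triangle (pts (2 * n + 1)) (Site.toComplex (cornerOrbit β q n).1) z])
  obtain ⟨lo, hi, E, F, T, pl, ph, p₀, -, hlopl, hp₀l, hp₀h, hphhi, hhi, hEd, hFd, hsub, htight, hwhole, hstrict,
    hinner, hends⟩ := key
  -- the chain bounds from the inner pieces
  have hchain : ∀ t, pl / 2 + 1 ≤ t → t ≤ (ph + 1) / 2 - 1 →
      r + 1 < dist (Site.toComplex (cornerOrbit β q t).1) z ∧ dist (Site.toComplex (cornerOrbit β q t).1) z < R - 1 ∧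
      r + 1 < dist (faceCenter (cFace (cornerOrbit β q t))) z ∧ dist (faceCenter (cFace (cornerOrbit β q t))) z < R - 1 := by
    intro t ht1 ht2
    have hmem : sPt (cornerOrbit β q t) ∈ segment ℝ (pts (2 * t)) (pts (2 * t + 1)) := by
      rw [hpts, pieceVert_even]; exact left_mem_segment _ _ _
    obtain ⟨hlo', hhi'⟩ := hinner (2 * t) (by omega) (by omega) _ hmem
    have hv := dist_sPt_vertex_lt (cornerOrbit β q t)
    have hf := dist_sPt_faceCenter_lt (cornerOrbit β q t)
    refine ⟨?_, ?_, ?_, ?_⟩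
    · linarith [dist_triangle (sPt (cornerOrbit β q t)) (Site.toComplex (cornerOrbit β q t).1) z]
    · linarith [dist_triangle (Site.toComplex (cornerOrbit β q t).1) (sPt (cornerOrbit β q t)) z,
        dist_comm (Site.toComplex (cornerOrbit β q t).1) (sPt (cornerOrbit β q t))]
    · linarith [dist_triangle (sPt (cornerOrbit β q t)) (faceCenter (cFace (cornerOrbit β q t))) z]
    · linarith [dist_triangle (faceCenter (cFace (cornerOrbit β q t))) (sPt (cornerOrbit β q t)) z,
        dist_comm (faceCenter (cFace (cornerOrbit β q t))) (sPt (cornerOrbit β q t))]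
  -- a point of the piece `pl` (resp. `ph`) is within `3/2` of the vertex and face centre of the chain end
  have hendl : ∀ w ∈ segment ℝ (pts pl) (pts (pl + 1)),
      dist w (Site.toComplex (cornerOrbit β q (pl / 2 + 1)).1) < 3 / 2 ∧
        dist w (faceCenter (cFace (cornerOrbit β q (pl / 2 + 1)))) < 3 / 2 :=
    fun w hw => ⟨piece_near_vertex β q (by omega) (by omega) hw, piece_near_faceCenter β q (by omega) (by omega) hw⟩
  have hendh : ∀ w ∈ segment ℝ (pts ph) (pts (ph + 1)),
      dist w (Site.toComplex (cornerOrbit β q ((ph + 1) / 2 - 1)).1) < 3 / 2 ∧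
        dist w (faceCenter (cFace (cornerOrbit β q ((ph + 1) / 2 - 1)))) < 3 / 2 :=
    fun w hw => ⟨piece_near_vertex β q (by omega) (by omega) hw, piece_near_faceCenter β q (by omega) (by omega) hw⟩
  have hdart : segment ℝ (sPt (cornerOrbit β q (p₀ / 2))) (tPt (cornerOrbit β q (p₀ / 2))) =
      segment ℝ (pts (2 * (p₀ / 2))) (pts (2 * (p₀ / 2) + 1)) := by
    rw [hpts, pieceVert_even, pieceVert_odd]
  refine ⟨E, F, T, p₀ / 2, pl / 2 + 1, (ph + 1) / 2 - 1, hEd, hFd, htight, ?_, ?_, ?_, by omega, by omega, by omega,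
    hchain, ?_⟩
  · intro w hw
    obtain ⟨p, hp, hw⟩ := mem_iUnion₂.1 (hsub hw)
    rw [Finset.mem_Icc] at hp
    exact mem_iUnion₂.2 ⟨p, Finset.mem_range.2 (by omega), hw⟩
  · rw [hdart]; exact hwhole _ (by omega) (by omega)
  · rw [hdart]; exact hstrict _ (by omega) (by omega)
  · rcases hends with ⟨⟨zl, hzl, hzld⟩, ⟨zh, hzh, hzhd⟩⟩ | ⟨⟨zl, hzl, hzld⟩, ⟨zh, hzh, hzhd⟩⟩
    · left
      obtain ⟨h1, h2⟩ := hendl zl hzl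
      obtain ⟨h3, h4⟩ := hendh zh hzh
      refine ⟨?_, ?_, ?_, ?_⟩
      · linarith [dist_triangle (Site.toComplex (cornerOrbit β q (pl / 2 + 1)).1) zl z,
          dist_comm (Site.toComplex (cornerOrbit β q (pl / 2 + 1)).1) zl]
      · linarith [dist_triangle (faceCenter (cFace (cornerOrbit β q (pl / 2 + 1)))) zl z,
          dist_comm (faceCenter (cFace (cornerOrbit β q (pl / 2 + 1)))) zl]
      · linarith [dist_triangle zh (Site.toComplex (cornerOrbit β q ((ph + 1) / 2 - 1)).1) z]
      · linarith [dist_triangle zh (faceCenter (cFace (cornerOrbit β q ((ph + 1) / 2 - 1)))) z]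
    · right
      obtain ⟨h1, h2⟩ := hendl zl hzl
      obtain ⟨h3, h4⟩ := hendh zh hzh
      refine ⟨?_, ?_, ?_, ?_⟩
      · linarith [dist_triangle zl (Site.toComplex (cornerOrbit β q (pl / 2 + 1)).1) z]
      · linarith [dist_triangle zl (faceCenter (cFace (cornerOrbit β q (pl / 2 + 1)))) z]
      · linarith [dist_triangle (Site.toComplex (cornerOrbit β q ((ph + 1) / 2 - 1)).1) zh z,
          dist_comm (Site.toComplex (cornerOrbit β q ((ph + 1) / 2 - 1)).1) zh]
      · linarith [dist_triangle (faceCenter (cFace (cornerOrbit β q ((ph + 1) / 2 - 1)))) zh z,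
          dist_comm (faceCenter (cFace (cornerOrbit β q ((ph + 1) / 2 - 1)))) zh]

/-- **The tight arc, the middle dart and the chain of an orbit stretch** (registered sub-goal
`ufrs_strandTightArc` of stmt-CriticalPhenomena-11387; the per-strand input of the sector argument
for `ufrs_strands_zdDomArms`, `strand_tightArc` in registered form). -/
theorem ufrs_strandTightArc : ∀ (β : BondConfig (Site 2)) (q : Site 2 × Fin 4) (n : ℕ) (z : ℂ) (r R : ℝ), r + 16 ≤ R → ((dist (Site.toComplex (cornerOrbit β q 0).1) z ≤ r ∧ R ≤ dist (Site.toComplex (cornerOrbit β q n).1) z) ∨ (R ≤ dist (Site.toComplex (cornerOrbit β q 0).1) z ∧ dist (Site.toComplex (cornerOrbit β q n).1) z ≤ r)) → ∃ (E F : ℂ) (T : Path E F) (m i' j' : ℕ), dist E z = r + 1 / 2 ∧ dist F z = R - 1 / 2 ∧ (∀ w ∈ Set.range T, r + 1 / 2 ≤ dist w z ∧ dist w z ≤ R - 1 / 2 ∧ (dist w z = r + 1 / 2 → w = E) ∧ (dist w z = R - 1 / 2 → w = F)) ∧ Set.range T ⊆ (⋃ jj ∈ Finset.range (2 * n + 1),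 segment ℝ (pieceVert β q jj) (pieceVert β q (jj + 1))) ∧ segment ℝ (sPt (cornerOrbit β q m)) (tPt (cornerOrbit β q m)) ⊆ Set.range T ∧ (∀ w ∈ segment ℝ (sPt (cornerOrbit β q m)) (tPt (cornerOrbit β q m)), r + 1 / 2 < dist w z ∧ dist w z < R - 1 / 2) ∧ i' ≤ m ∧ m ≤ j' ∧ j' ≤ n ∧ (∀ t, i' ≤ t → t ≤ j' → r + 1 < dist (Site.toComplex (cornerOrbit β q t).1) z ∧ dist (Site.toComplex (cornerOrbit β q t).1) z < R - 1 ∧ r + 1 < dist (faceCenter (cFace (cornerOrbit β q t))) z ∧ dist (faceCenter (cFace (cornerOrbit β q t))) z < R - 1) ∧ ((dist (Site.toComplex (cornerOrbit β q i').1) z < r + 3 ∧ dist (faceCenter (cFace (cornerOrbit β q i'))) z < r + 3 ∧ R - 3 < dist (Site.toComplex (cornerOrbit β q j').1) z ∧ R - 3 < dist (faceCenter (cFace (cornerOrbit β q j'))) z) ∨ (R - 3 < dist (Site.toComplex (cornerOrbit β q i').1) z ∧ R - 3 < dist (faceCenter (cFace (cornerOrbit β q i'))) z ∧ dist (Site.toComplex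 (cornerOrbit β q j').1) z < r + 3 ∧ dist (faceCenter (cFace (cornerOrbit β q j'))) z < r + 3)) :=
  fun β q n z _r _R hrR hdir => strand_tightArc β q n z hrR hdir

end

end Summit.CriticalPhenomena.CardyFormulaZ2.Cruxes.EdgePrecompact.QkzStripBoundaryArm
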